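import Summits.CriticalPhenomena.PercolationContinuityZ3.Theorems.PercNearOneGluingAdditiveGluingDConeAssembly
import Summits.CriticalPhenomena.PercolationContinuityZ3.Theorems.PercNearOneGluingAdditiveGluingInterpSwitch
import HarnessLib

/-! # Crux `PercNearOneGluing.AdditiveGluing` (stmt-CriticalPhenomena-4576) — the designated-pocket kernel is MULTI-AFFINE:
# exact interpolation in every pair weight, the `κ`-down-set of good designations, and the Lemma-5 leaf (seat (d) round 4)

Support file (`--supports stmt-CriticalPhenomena-4576`); no definitions, no named facts.

`μ_u = prodBernoulli u`; relays `A ∋ b`; a block `S`; `u/S` = the glued weighting (non-loop pairs inside `S` at weight `1`).  The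
designated-pocket kernel of `additiveGluing_of_dcone` at a designation `d` is
  `D(u,S,d) :  κ_{u/S}(d) := μ_{u/S}((S ↔ A) ∩ (d ↔ b)) ≤ μ_{u/S}(S ↔ b)`.
* `dKernel_mono_designated` (**down-set**): `D(u,S,d) ∧ κ_{u/S}(a₀) ≤ κ_{u/S}(d) → D(u,S,a₀)` (one `le_trans`).
* `dKernel_glue_update` / `dKernel_interp` (**exact interpolation**): for EVERY pair `e`, both sides of `D` are affine in the weight of
  `e` (one-bond decomposition `stub_oneBondDecomp_k15` in the glued weighting; a pair inside `S` is glued anyway), hence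
  `D(u[e↦0],S,d) ∧ D(u[e↦1],S,d) → D(u,S,d)` — with NO concavity loss (contrast `interpSw_slack_ge` for block goodness, where the
  worst-selection pocket term is only concave).
* `dKernel_of_leaf` (**Lemma 5 leaf**): `μ_u(d ↔ b) ≤ μ_u(v ↔ b)` for some `v ∈ S ∌ b` gives `D(u,S,d)` (`stub_gluingLemma5`).
* `dKernel_of_interpSwitch`: hence `D(u,S,a₀)` as soon as, for some pair `e`, `a₀` is `κ`-below a `D`-good designation of `u[e↦0]`
  and `κ`-below a `D`-good designation of `u[e↦1]` (e.g. the minimisers of the endpoint two-point functions, `D`-good by the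
  inner induction on `#positive + #fractional` pairs).
Census of this seat (lab/dcert.py, lab/t8_annealD.py): the calculus {this interpolation, leaf, KN Thm 2 at the designation
(`dKernel_three_of_knThm2`), deletion switches} certified `D(u,S,a₀)` in every instance reached by ~60 adversarial annealing chains
(n ≤ 8, 3–4 relays); chains stall exactly on the boundary where the KN-2 certificate vanishes, across which the other routes take over.
[cite: KozmaNitzan2024, §5.3 p. 34 (linearity in one edge weight), §3.2 Lemma 5 p. 13, Question 9 p. 36]
-/

namespace Summit.CriticalPhenomena.PercolationContinuityZ3.Theorems

open MeasureTheory Set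
open Literature.Probability.LatticeModels (prodBernoulli)
open Literature.Probability.Percolation (BondConfig openConn openConnIn openGraph openCluster)
open scoped BigOperators

noncomputable section
open Classical

section DKernelInterp

open Literature.Probability.LatticeModels Literature.Probability.Percolation

variable {n : ℕ}

/-- **The `D`-good designations form a down-set of `κ`.** [cite: KozmaNitzan2024, §3.2 p. 12] -/
theorem dKernel_mono_designated (g : Sym2 (Fin n) → unitInterval) (A S : Finset (Fin n)) (b a₀ d : Fin n)
    (hle : (prodBernoulli g).real ((⋃ v ∈ S, ⋃ a ∈ A, openConn v a) ∩ openConn a₀ b)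
      ≤ (prodBernoulli g).real ((⋃ v ∈ S, ⋃ a ∈ A, openConn v a) ∩ openConn d b))
    (hd : (prodBernoulli g).real ((⋃ v ∈ S, ⋃ a ∈ A, openConn v a) ∩ openConn d b)
      ≤ (prodBernoulli g).real (⋃ v ∈ S, openConn v b)) :
    (prodBernoulli g).real ((⋃ v ∈ S, ⋃ a ∈ A, openConn v a) ∩ openConn a₀ b)
      ≤ (prodBernoulli g).real (⋃ v ∈ S, openConn v b) :=
  le_trans hle hd

/-- Updating a pair and gluing commute when the pair is not a non-loop pair inside the block. [folklore] -/
theorem dKernel_glue_update (u : Sym2 (Fin n) → unitInterval) (S : Finset (Fin n)) (e : Sym2 (Fin n)) (t : unitInterval)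
    (he : ¬ ((∀ y ∈ e, y ∈ S) ∧ ¬ e.IsDiag)) :
    Function.update (fun e' : Sym2 (Fin n) => if (∀ y ∈ e', y ∈ S) ∧ ¬ e'.IsDiag then 1 else u e') e t
      = (fun e' : Sym2 (Fin n) => if (∀ y ∈ e', y ∈ S) ∧ ¬ e'.IsDiag then 1 else Function.update u e t e') := by
  funext e'
  by_cases hee : e' = e
  · subst hee
    rw [Function.update_self, if_neg he, Function.update_self]
  · rw [Function.update_of_ne hee, Function.update_of_ne hee]

/-- Gluing ignores the weight of a non-loop pair inside the block. [folklore] -/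
theorem dKernel_glue_update_inside (u : Sym2 (Fin n) → unitInterval) (S : Finset (Fin n)) (e : Sym2 (Fin n)) (t : unitInterval)
    (he : (∀ y ∈ e, y ∈ S) ∧ ¬ e.IsDiag) :
    (fun e' : Sym2 (Fin n) => if (∀ y ∈ e', y ∈ S) ∧ ¬ e'.IsDiag then 1 else Function.update u e t e')
      = (fun e' : Sym2 (Fin n) => if (∀ y ∈ e', y ∈ S) ∧ ¬ e'.IsDiag then 1 else u e') := by
  funext e'
  by_cases hee : e' = e
  · subst hee
    rw [if_pos he, if_pos he]
  · rw [Function.update_of_ne hee]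

/-- **Exact interpolation of the designated-pocket kernel in one pair weight**: for every pair `e`,
`D(u[e↦0],S,d) ∧ D(u[e↦1],S,d) → D(u,S,d)`.  [cite: KozmaNitzan2024, §5.3 p. 34] -/
theorem dKernel_interp (u : Sym2 (Fin n) → unitInterval) (A S : Finset (Fin n)) (b d : Fin n) (e : Sym2 (Fin n))
    (h0 : (prodBernoulli (fun e' : Sym2 (Fin n) => if (∀ y ∈ e', y ∈ S) ∧ ¬ e'.IsDiag then 1 else Function.update u e 0 e')).real
          ((⋃ v ∈ S, ⋃ a ∈ A, openConn v a) ∩ openConn d b)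
        ≤ (prodBernoulli (fun e' : Sym2 (Fin n) => if (∀ y ∈ e', y ∈ S) ∧ ¬ e'.IsDiag then 1 else Function.update u e 0 e')).real
          (⋃ v ∈ S, openConn v b))
    (h1 : (prodBernoulli (fun e' : Sym2 (Fin n) => if (∀ y ∈ e', y ∈ S) ∧ ¬ e'.IsDiag then 1 else Function.update u e 1 e')).real
          ((⋃ v ∈ S, ⋃ a ∈ A, openConn v a) ∩ openConn d b)
        ≤ (prodBernoulli (fun e' : Sym2 (Fin n) => if (∀ y ∈ e', y ∈ S) ∧ ¬ e'.IsDiag then 1 else Function.update u e 1 e')).real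
          (⋃ v ∈ S, openConn v b)) :
    (prodBernoulli (fun e' : Sym2 (Fin n) => if (∀ y ∈ e', y ∈ S) ∧ ¬ e'.IsDiag then 1 else u e')).real
        ((⋃ v ∈ S, ⋃ a ∈ A, openConn v a) ∩ openConn d b)
      ≤ (prodBernoulli (fun e' : Sym2 (Fin n) => if (∀ y ∈ e', y ∈ S) ∧ ¬ e'.IsDiag then 1 else u e')).real
        (⋃ v ∈ S, openConn v b) := by
  by_cases he : (∀ y ∈ e, y ∈ S) ∧ ¬ e.IsDiag
  · rw [dKernel_glue_update_inside u S e 1 he] at h1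
    exact h1
  set g : Sym2 (Fin n) → unitInterval := fun e' : Sym2 (Fin n) => if (∀ y ∈ e', y ∈ S) ∧ ¬ e'.IsDiag then 1 else u e' with hg
  have hE := stub_oneBondDecomp_k15 n g e ((⋃ v ∈ S, ⋃ a ∈ A, openConn v a) ∩ openConn d b)
  have hY := stub_oneBondDecomp_k15 n g e (⋃ v ∈ S, openConn v b)
  have hup0 : Function.update g e 0
      = (fun e' : Sym2 (Fin n) => if (∀ y ∈ e', y ∈ S) ∧ ¬ e'.IsDiag then 1 else Function.update u e 0 e') := by
    rw [hg]; exact dKernel_glue_update u S e 0 he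
  have hup1 : Function.update g e 1
      = (fun e' : Sym2 (Fin n) => if (∀ y ∈ e', y ∈ S) ∧ ¬ e'.IsDiag then 1 else Function.update u e 1 e') := by
    rw [hg]; exact dKernel_glue_update u S e 1 he
  have hge : g e = u e := by rw [hg]; exact if_neg he
  rw [hup0, hup1, hge] at hE hY
  have ht0 : 0 ≤ (u e : ℝ) := (u e).2.1
  have ht1 : (u e : ℝ) ≤ 1 := (u e).2.2
  rw [hE, hY]
  nlinarith [mul_le_mul_of_nonneg_left h0 (sub_nonneg.2 ht1), mul_le_mul_of_nonneg_left h1 ht0]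

/-- **Lemma-5 leaf for the designated-pocket kernel**: if `μ_u(d ↔ b) ≤ μ_u(v ↔ b)` for some `v ∈ S ∌ b`, then `D(u,S,d)`.
[cite: KozmaNitzan2024, §3.2 Lemma 5 p. 13] -/
theorem dKernel_of_leaf (u : Sym2 (Fin n) → unitInterval) (A S : Finset (Fin n)) (b d v : Fin n)
    (hv : v ∈ S) (hbS : b ∉ S)
    (hle : (prodBernoulli u).real (openConn d b) ≤ (prodBernoulli u).real (openConn v b)) :
    (prodBernoulli (fun e' : Sym2 (Fin n) => if (∀ y ∈ e', y ∈ S) ∧ ¬ e'.IsDiag then 1 else u e')).real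
        ((⋃ v ∈ S, ⋃ a ∈ A, openConn v a) ∩ openConn d b)
      ≤ (prodBernoulli (fun e' : Sym2 (Fin n) => if (∀ y ∈ e', y ∈ S) ∧ ¬ e'.IsDiag then 1 else u e')).real
        (⋃ v ∈ S, openConn v b) := by
  have h5 := stub_gluingLemma5 n u S d v b hv hbS hle
  exact le_trans (measureReal_mono Set.inter_subset_right (measure_ne_top _ _)) h5

/-- **THE INTERPOLATION SWITCH for the designated-pocket kernel.**  For any pair `e`: if `d₀` is `D`-good for `(u[e↦0], S)` and
`d₁` is `D`-good for `(u[e↦1], S)` (e.g. endpoint minimisers, by the inner induction), and `a₀` is `κ`-below `d₀` in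
`u[e↦0]/S` and `κ`-below `d₁` in `u[e↦1]/S`, then `D(u,S,a₀)`.  [cite: KozmaNitzan2024, §5.3 p. 34, Question 9 p. 36] -/
theorem dKernel_of_interpSwitch (u : Sym2 (Fin n) → unitInterval) (A S : Finset (Fin n)) (b a₀ d₀ d₁ : Fin n)
    (e : Sym2 (Fin n))
    (hle0 : (prodBernoulli (fun e' : Sym2 (Fin n) => if (∀ y ∈ e', y ∈ S) ∧ ¬ e'.IsDiag then 1 else Function.update u e 0 e')).real
          ((⋃ v ∈ S, ⋃ a ∈ A, openConn v a) ∩ openConn a₀ b)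
      ≤ (prodBernoulli (fun e' : Sym2 (Fin n) => if (∀ y ∈ e', y ∈ S) ∧ ¬ e'.IsDiag then 1 else Function.update u e 0 e')).real
          ((⋃ v ∈ S, ⋃ a ∈ A, openConn v a) ∩ openConn d₀ b))
    (hle1 : (prodBernoulli (fun e' : Sym2 (Fin n) => if (∀ y ∈ e', y ∈ S) ∧ ¬ e'.IsDiag then 1 else Function.update u e 1 e')).real
          ((⋃ v ∈ S, ⋃ a ∈ A, openConn v a) ∩ openConn a₀ b)
      ≤ (prodBernoulli (fun e' : Sym2 (Fin n) => if (∀ y ∈ e', y ∈ S) ∧ ¬ e'.IsDiag then 1 else Function.update u e 1 e')).real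
          ((⋃ v ∈ S, ⋃ a ∈ A, openConn v a) ∩ openConn d₁ b))
    (hD0 : (prodBernoulli (fun e' : Sym2 (Fin n) => if (∀ y ∈ e', y ∈ S) ∧ ¬ e'.IsDiag then 1 else Function.update u e 0 e')).real
          ((⋃ v ∈ S, ⋃ a ∈ A, openConn v a) ∩ openConn d₀ b)
      ≤ (prodBernoulli (fun e' : Sym2 (Fin n) => if (∀ y ∈ e', y ∈ S) ∧ ¬ e'.IsDiag then 1 else Function.update u e 0 e')).real
          (⋃ v ∈ S, openConn v b))
    (hD1 : (prodBernoulli (fun e' : Sym2 (Fin n) => if (∀ y ∈ e', y ∈ S) ∧ ¬ e'.IsDiag then 1 else Function.update u e 1 e')).real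
          ((⋃ v ∈ S, ⋃ a ∈ A, openConn v a) ∩ openConn d₁ b)
      ≤ (prodBernoulli (fun e' : Sym2 (Fin n) => if (∀ y ∈ e', y ∈ S) ∧ ¬ e'.IsDiag then 1 else Function.update u e 1 e')).real
          (⋃ v ∈ S, openConn v b)) :
    (prodBernoulli (fun e' : Sym2 (Fin n) => if (∀ y ∈ e', y ∈ S) ∧ ¬ e'.IsDiag then 1 else u e')).real
        ((⋃ v ∈ S, ⋃ a ∈ A, openConn v a) ∩ openConn a₀ b)
      ≤ (prodBernoulli (fun e' : Sym2 (Fin n) => if (∀ y ∈ e', y ∈ S) ∧ ¬ e'.IsDiag then 1 else u e')).real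
        (⋃ v ∈ S, openConn v b) :=
  dKernel_interp u A S b a₀ e (le_trans hle0 hD0) (le_trans hle1 hD1)

end DKernelInterp

end

end Summit.CriticalPhenomena.PercolationContinuityZ3.Theorems
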